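import Literature.NumberTheory.EllipticCurves.NewformsLevelRaising
import Literature.NumberTheory.EllipticCurves.CuspFormLFunctionFrickeProofs
import Literature.NumberTheory.EllipticCurves.HeckeOperatorsProofs
import Literature.NumberTheory.EllipticCurves.ModularSymbolsPeriodHomology
import Literature.NumberTheory.EllipticCurves.EichlerShimuraMapDegree
import HarnessLib

/-!
# The `S`-depleted eigenform `g = ∑_{(n,S)=1} a_n(f) qⁿ ∈ S₂(Γ₀(M·∏_{ℓ∈S} ℓ²))` of a Hecke eigenform `f ∈ S₂(Γ₀(M))`:
# existence, Hecke relations, and its periods `(∏_{ℓ∈S} ℓ²)·Λ_g ⊆ Λ_f` (Atkin–Lehner 1970 §3; Cremona 1997 §2.4)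

Topic `Literature/NumberTheory/EllipticCurves`, next to `NewformsLevelRaising.lean` (the level-raising maps `ι_d`, `toLevel0`,
the operators `U_p = uOp`, the sieve `K_p = 1 − ι_p U_p = sieveOp` and `qExpansion_coeff_sieveOp`). THEOREMS ONLY (no
definition, no named fact, no `sorry`), namespace `Literature.NumberTheory.EllipticCurves.ModularForms.DepletedForm`.

PROVENANCE (library hygiene, not new mathematics). §1–§3 and §4–§6 below are the Summit-side theorem files
`Summits/BirchSwinnertonDyer/BirchSwinnertonDyer/Theorems/ResidualThetaTransportAtTwoThetaLayerLambdaCongruenceAtTwoStarDepletedForm.lean`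
(seat bsd-wall-rtt-p3-w3 g3) and §1–§3 of
`Summits/BirchSwinnertonDyer/BirchSwinnertonDyer/Theorems/ThetaPartnerAtTwoMazurTateCongruenceAtTwoRDepletedPeriodLattice.lean`
(seat bsd-wall-tp2-p1-w2 g5, p636031), moved VERBATIM (namespaces only; the uncited plumbing lemmas made `private`) into `Literature/`, where they belong — they are
statements about cusp forms on `Γ₀`, with no reference to any summit — so that Literature files (which may not import
`Summits/`) can use them; first user: `EichlerShimuraOptimalQuotientLatticeProofs.lean`, the discharge of the named fact
`eichlerShimura_depletedOptimalQuotient_periodLattice(_of_dvd)`. The Summit-side copies can be re-derived from these by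
one-line proofs (planner/prover business; not done here).

WHAT.
* §1 `exists_cuspForm_coeff_eq_depleted`: for `f ∈ S₂(Γ₀(M))` and a finite set `S` of primes there is `g ∈ S₂(Γ₀(L))`,
  `L = M·∏_{ℓ∈S} ℓ²`, with `a_n(g) = 0` if some `ℓ ∈ S` divides `n` and `a_n(g) = a_n(f)` otherwise (induction on `S` with
  the sieve `sieveOp`; Atkin–Lehner's `f ↦ f − f∣U_ℓ∣B_ℓ`).
* §2 `depleted_heckeT_eq_smul` / `depleted_heckeT_eq_zero` / `depleted_coeff_one` / `depleted_coeff_int` / `depleted_coeff_im`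
  / `depleted_heckeT_eq_coeff_smul`: if `T_p f = a_p(f) f` for all primes `p` then `T_p g = a_p(f) g` for `p ∉ S`, `U_ℓ g = 0`
  for `ℓ ∈ S`, `a₁(g) = a₁(f)`, integrality / reality of coefficients is inherited, and `T_p g = a_p(g) g` for every prime.
* §3 `exists_depleted_eigenform`: the package.
* §4 `modularSymbol_iota`, `exists_cuspSymbol_iota`: `{∞, r}_{ι_d h} = d⁻¹{∞, dr}_h` (Cremona 1997 §2.4) and
  `{∞, γ∞}_{ι_d h} = d⁻¹{∞, δ∞}_h` with `δ ∈ Γ₀(M)` read off the first column of `γ` (`Gamma0.mkOfCol`);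
  `cuspSymbol_toLevel0`: periods are unchanged under level raising.
* §5 `mul_cuspSymbol_depleted_mem_of_eq`: `(∏_{ℓ∈S} ℓ²)·{∞, γ∞}_g ∈ Λ_f` for `f` with integer coefficients and
  `T_p f = a_p(f) f` — induction over the sieve `g = K_ℓ g₀ = g₀ − ι_ℓ(T_ℓ g₀ − 𝟙_{ℓ∤L₀} ℓ ι_ℓ g₀)`, `T_ℓ g₀ = a_ℓ(f) g₀`,
  `a_ℓ(f) ∈ ℤ`.
* §6 `mul_cuspSymbol_depleted_mem` (any level `L` with `M·∏ℓ² ∣ L`) and `mul_mem_periodLattice_of_mem_periodLattice_depleted`: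
  `(∏_{ℓ∈S} ℓ²)·Λ_g ⊆ Λ_f`.
Nothing about any elliptic curve is asserted here; no summit statement is proved by any of this.

## References

* A. O. L. Atkin, J. Lehner, *Hecke operators on `Γ₀(m)`*, Math. Ann. 185 (1970), 134–160: §2–§3 (the operators `B_d`,
  `U_p`, `f ↦ f − f∣U_p∣B_p`). [AtkinLehner1970]
* F. Diamond, J. Shurman, *A First Course in Modular Forms*, GTM 228 (2005): Prop. 5.2.2(a), 5.3.1, 5.8.5, §5.7–5.8.
  [DiamondShurman2005]
* J. E. Cremona, *Algorithms for modular elliptic curves*, 2nd ed. (1997): §2.4 (the substitution for `f(dz)`), §2.14.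
  [CremonaAlgorithms1997]
-/

noncomputable section

open scoped MatrixGroups ModularForm

open CongruenceSubgroup

namespace Literature.NumberTheory.EllipticCurves.ModularForms.DepletedForm

section DepletedFormCoefficients

open _root_.UpperHalfPlane

/-! ## §1. Existence of the depleted form by iterating the sieve -/

section Existence

/-- A product of squares of primes is nonzero. [folklore] -/
private theorem prod_sq_ne_zero_of_prime (S : Finset ℕ) (hS : ∀ ℓ ∈ S, ℓ.Prime) : ∏ ℓ ∈ S, ℓ ^ 2 ≠ 0 :=
  Finset.prod_ne_zero_iff.mpr fun ℓ hℓ ↦ pow_ne_zero 2 (hS ℓ hℓ).ne_zero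

/-- **The `S`-depleted form exists.** For `f ∈ S₂(Γ₀(M))` and a finite set `S` of primes, at level
`L = M · ∏_{ℓ∈S} ℓ²` there is a cusp form `g` with `a_n(g) = 0` when some `ℓ ∈ S` divides `n` and `a_n(g) = a_n(f)`
otherwise — the iterate of the tree's sieves `K_ℓ = 1 − ι_ℓ U_ℓ` (Atkin–Lehner `f − f∣U_ℓ∣B_ℓ`).
[cite: AtkinLehner1970, §3] -/
theorem exists_cuspForm_coeff_eq_depleted {M : ℕ} [NeZero M] (f : CuspForm (Gamma0 M) 2) (S : Finset ℕ)
    (hS : ∀ ℓ ∈ S, ℓ.Prime) (L : ℕ) [NeZero L] (hL : L = M * ∏ ℓ ∈ S, ℓ ^ 2) :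
    ∃ g : CuspForm (Gamma0 L) 2, ∀ n : ℕ, cuspCoeff g n = if ∃ ℓ ∈ S, ℓ ∣ n then 0 else cuspCoeff f n := by
  classical
  induction S using Finset.induction_on generalizing L with
  | empty =>
    subst hL
    refine ⟨toLevel0 (dvd_mul_right M _) 2 f, fun n ↦ ?_⟩
    simp only [Finset.notMem_empty, false_and, exists_false, if_false]
    rfl
  | insert ℓ S hℓS ih =>
    have hSp : ∀ ℓ' ∈ S, ℓ'.Prime := fun ℓ' h ↦ hS ℓ' (Finset.mem_insert_of_mem h)
    have hℓ : ℓ.Prime := hS ℓ (Finset.mem_insert_self ℓ S)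
    set L₀ : ℕ := M * ∏ ℓ' ∈ S, ℓ' ^ 2 with hL₀
    haveI : NeZero L₀ := ⟨mul_ne_zero (NeZero.ne M) (prod_sq_ne_zero_of_prime S hSp)⟩
    haveI : NeZero ℓ := ⟨hℓ.ne_zero⟩
    obtain ⟨g₀, hg₀⟩ := ih hSp L₀ rfl
    have hL' : L = L₀ * ℓ * ℓ := by
      rw [hL, Finset.prod_insert hℓS, hL₀]; ring
    subst hL'
    refine ⟨sieveOp L₀ 2 ℓ g₀, fun n ↦ ?_⟩
    change (qExpansion 1 ⇑(sieveOp L₀ 2 ℓ g₀)).coeff n = _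
    rw [qExpansion_coeff_sieveOp hℓ g₀ n]
    change (if ℓ ∣ n then 0 else cuspCoeff g₀ n) = _
    rw [hg₀ n]
    by_cases hℓn : ℓ ∣ n
    · rw [if_pos hℓn, if_pos ⟨ℓ, Finset.mem_insert_self ℓ S, hℓn⟩]
    · rw [if_neg hℓn]
      by_cases hex : ∃ ℓ' ∈ S, ℓ' ∣ n
      · obtain ⟨ℓ', hℓ', hd⟩ := hex
        rw [if_pos ⟨ℓ', hℓ', hd⟩, if_pos ⟨ℓ', Finset.mem_insert_of_mem hℓ', hd⟩]
      · rw [if_neg hex, if_neg]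
        rintro ⟨ℓ', hℓ', hd⟩
        rcases Finset.mem_insert.mp hℓ' with rfl | h
        · exact hℓn hd
        · exact hex ⟨ℓ', h, hd⟩

end Existence

/-! ## §2. Hecke relations of the depleted form from its coefficients -/

section Hecke

variable {M L : ℕ} [NeZero M] [NeZero L]

/-- `a_n(T_p h) = a_{pn}(h) + 𝟙_{p∤L}·p·𝟙_{p∣n}·a_{n/p}(h)` in weight `2` (the tree's `qExpansion_coeff_heckeT_holds`).
[cite: DiamondShurman2005, Prop. 5.2.2(a) and Prop. 5.3.1] -/
theorem cuspCoeff_heckeT_two (h : CuspForm (Gamma0 L) 2) {p : ℕ} (hp : p.Prime) (n : ℕ) :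
    cuspCoeff ((haveI : NeZero p := ⟨hp.ne_zero⟩; heckeT (Gamma0 L) 2 p) h) n =
      cuspCoeff h (p * n) + (if p ∣ L then 0 else (p : ℂ) * (if p ∣ n then cuspCoeff h (n / p) else 0)) := by
  haveI : NeZero p := ⟨hp.ne_zero⟩
  have e := qExpansion_coeff_heckeT_holds L 2 h p hp n
  rw [show ((2 : ℤ) - 1) = 1 by norm_num, zpow_one] at e
  exact e

/-- The Hecke recursion of an eigenvector: `T_p f = a • f` gives `a·a_m(f) = a_{pm}(f) + 𝟙_{p∤M} p 𝟙_{p∣m} a_{m/p}(f)`.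
[cite: DiamondShurman2005, Prop. 5.8.5] -/
theorem coeff_recursion_of_heckeT_eq_smul (f : CuspForm (Gamma0 M) 2) {p : ℕ} (hp : p.Prime) {a : ℂ}
    (hT : (haveI : NeZero p := ⟨hp.ne_zero⟩; heckeT (Gamma0 M) 2 p f) = a • f) (m : ℕ) :
    a * cuspCoeff f m = cuspCoeff f (p * m) + (if p ∣ M then 0 else (p : ℂ) * (if p ∣ m then cuspCoeff f (m / p) else 0)) := by
  rw [← cuspCoeff_heckeT_two f hp m, hT, cuspCoeff_smul]

variable {S : Finset ℕ} {f : CuspForm (Gamma0 M) 2} {g : CuspForm (Gamma0 L) 2}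

omit [NeZero M] [NeZero L] in
/-- `a₁(g) = a₁(f)` for the depleted form. [folklore] -/
private theorem depleted_coeff_one (hS : ∀ ℓ ∈ S, ℓ.Prime)
    (hg : ∀ n : ℕ, cuspCoeff g n = if ∃ ℓ ∈ S, ℓ ∣ n then 0 else cuspCoeff f n) :
    cuspCoeff g 1 = cuspCoeff f 1 := by
  rw [hg 1, if_neg]
  rintro ⟨ℓ, hℓ, hd⟩
  exact (hS ℓ hℓ).ne_one (Nat.dvd_one.mp hd)

omit [NeZero M] [NeZero L] in
/-- Integer coefficients are inherited by the depleted form. [folklore] -/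
private theorem depleted_coeff_int (hint : ∀ n : ℕ, ∃ z : ℤ, cuspCoeff f n = z)
    (hg : ∀ n : ℕ, cuspCoeff g n = if ∃ ℓ ∈ S, ℓ ∣ n then 0 else cuspCoeff f n) (n : ℕ) :
    ∃ z : ℤ, cuspCoeff g n = z := by
  rw [hg n]
  split_ifs
  · exact ⟨0, by simp⟩
  · exact hint n

omit [NeZero M] [NeZero L] in
/-- Real coefficients are inherited by the depleted form. [folklore] -/
private theorem depleted_coeff_im (hreal : ∀ n : ℕ, (cuspCoeff f n).im = 0)
    (hg : ∀ n : ℕ, cuspCoeff g n = if ∃ ℓ ∈ S, ℓ ∣ n then 0 else cuspCoeff f n) (n : ℕ) :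
    (cuspCoeff g n).im = 0 := by
  rw [hg n]
  split_ifs
  · simp
  · exact hreal n

omit [NeZero M] in
/-- **`U_ℓ g = 0` for `ℓ ∈ S`** (`ℓ ∣ L`): `a_n(U_ℓ g) = a_{ℓn}(g) = 0`. [cite: AtkinLehner1970, §3] -/
theorem depleted_heckeT_eq_zero (hg : ∀ n : ℕ, cuspCoeff g n = if ∃ ℓ ∈ S, ℓ ∣ n then 0 else cuspCoeff f n)
    {ℓ : ℕ} (hℓ : ℓ.Prime) (hℓS : ℓ ∈ S) (hℓL : ℓ ∣ L) :
    (haveI : NeZero ℓ := ⟨hℓ.ne_zero⟩; heckeT (Gamma0 L) 2 ℓ g) = 0 := by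
  haveI : NeZero ℓ := ⟨hℓ.ne_zero⟩
  refine eq_of_forall_cuspCoeff_eq_gamma0 fun n ↦ ?_
  rw [cuspCoeff_heckeT_two g hℓ n, if_pos hℓL, add_zero, hg (ℓ * n), if_pos ⟨ℓ, hℓS, dvd_mul_right ℓ n⟩]
  change (0 : ℂ) = (qExpansion 1 ⇑(0 : CuspForm (Gamma0 L) 2)).coeff n
  rw [CuspForm.coe_zero, UpperHalfPlane.qExpansion_zero]
  simp

/-- **`T_p g = a_p(f) g` for primes `p ∉ S`**, when `T_p f = a_p(f) f` and `p ∣ L ↔ p ∣ M` (the levels have the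
same primes outside `S`). [cite: AtkinLehner1970, §3] -/
theorem depleted_heckeT_eq_smul (hS : ∀ ℓ ∈ S, ℓ.Prime)
    (hg : ∀ n : ℕ, cuspCoeff g n = if ∃ ℓ ∈ S, ℓ ∣ n then 0 else cuspCoeff f n)
    {p : ℕ} (hp : p.Prime) (hpS : p ∉ S) (hpLM : p ∣ L ↔ p ∣ M)
    (hT : (haveI : NeZero p := ⟨hp.ne_zero⟩; heckeT (Gamma0 M) 2 p f) = cuspCoeff f p • f) :
    (haveI : NeZero p := ⟨hp.ne_zero⟩; heckeT (Gamma0 L) 2 p g) = cuspCoeff f p • g := by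
  haveI : NeZero p := ⟨hp.ne_zero⟩
  classical
  -- divisibility bookkeeping: `p` is coprime to every `ℓ ∈ S`
  have hcop : ∀ ℓ ∈ S, Nat.Coprime ℓ p := fun ℓ hℓ ↦
    (Nat.coprime_primes (hS ℓ hℓ) hp).mpr fun h ↦ hpS (h ▸ hℓ)
  have hiff : ∀ n, (∃ ℓ ∈ S, ℓ ∣ p * n) ↔ (∃ ℓ ∈ S, ℓ ∣ n) := fun n ↦ by
    constructor
    · rintro ⟨ℓ, hℓ, hd⟩
      exact ⟨ℓ, hℓ, (hcop ℓ hℓ).dvd_of_dvd_mul_left hd⟩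
    · rintro ⟨ℓ, hℓ, hd⟩
      exact ⟨ℓ, hℓ, hd.mul_left p⟩
  have hiff' : ∀ n, p ∣ n → ((∃ ℓ ∈ S, ℓ ∣ n / p) ↔ (∃ ℓ ∈ S, ℓ ∣ n)) := fun n hpn ↦ by
    obtain ⟨m, rfl⟩ := hpn
    rw [Nat.mul_div_cancel_left m hp.pos]
    exact (hiff m).symm
  refine eq_of_forall_cuspCoeff_eq_gamma0 fun n ↦ ?_
  rw [cuspCoeff_heckeT_two g hp n, cuspCoeff_smul, hg (p * n), hg n]
  have hrec := coeff_recursion_of_heckeT_eq_smul f hp hT n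
  by_cases hex : ∃ ℓ ∈ S, ℓ ∣ n
  · -- all terms vanish
    rw [if_pos ((hiff n).mpr hex), if_pos hex, mul_zero]
    by_cases hpn : p ∣ n
    · rw [if_pos hpn, hg (n / p), if_pos ((hiff' n hpn).mpr hex)]
      simp
    · rw [if_neg hpn]
      simp
  · rw [if_neg ((hiff n).not.mpr hex), if_neg hex, hrec]
    congr 1
    by_cases hpM : p ∣ M
    · rw [if_pos hpM, if_pos (hpLM.mpr hpM)]
    · rw [if_neg hpM, if_neg (fun h ↦ hpM (hpLM.mp h))]
      by_cases hpn : p ∣ n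
      · rw [if_pos hpn, if_pos hpn, hg (n / p), if_neg ((hiff' n hpn).not.mpr hex)]
      · rw [if_neg hpn, if_neg hpn]

/-- **`T_p g = a_p(g) g` for EVERY prime `p`** (the eigenform hypothesis of
`eichlerShimura_optimalQuotient_periodLattice`): for `p ∉ S` it is `a_p(f) g` with `a_p(g) = a_p(f)`; for `ℓ ∈ S`
both sides vanish (`U_ℓ g = 0`, `a_ℓ(g) = 0`). Requires every `ℓ ∈ S` to divide `L` and `p ∣ L ↔ p ∣ M` off `S`.
[cite: AtkinLehner1970, §3] -/
theorem depleted_heckeT_eq_coeff_smul (hS : ∀ ℓ ∈ S, ℓ.Prime) (hSL : ∀ ℓ ∈ S, ℓ ∣ L)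
    (hLM : ∀ p : ℕ, p.Prime → p ∉ S → (p ∣ L ↔ p ∣ M))
    (hg : ∀ n : ℕ, cuspCoeff g n = if ∃ ℓ ∈ S, ℓ ∣ n then 0 else cuspCoeff f n)
    (hT : ∀ (p : ℕ) (hp : p.Prime), (haveI : NeZero p := ⟨hp.ne_zero⟩; heckeT (Gamma0 M) 2 p f) = cuspCoeff f p • f)
    (p : ℕ) (hp : p.Prime) :
    (haveI : NeZero p := ⟨hp.ne_zero⟩; heckeT (Gamma0 L) 2 p g) = cuspCoeff g p • g := by
  by_cases hpS : p ∈ S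
  · rw [depleted_heckeT_eq_zero hg hp hpS (hSL p hpS), hg p, if_pos ⟨p, hpS, dvd_rfl⟩, zero_smul]
  · rw [depleted_heckeT_eq_smul hS hg hp hpS (hLM p hp hpS) (hT p hp), hg p, if_neg]
    rintro ⟨ℓ, hℓ, hd⟩
    exact hpS (((Nat.prime_dvd_prime_iff_eq (hS ℓ hℓ) hp).mp hd) ▸ hℓ)

end Hecke

/-! ## §3. The package -/

section Package

/-- Primes of `L = M·∏_{ℓ∈S} ℓ²` off `S` are the primes of `M`. [folklore] -/
private theorem dvd_level_iff {M : ℕ} {S : Finset ℕ} (hS : ∀ ℓ ∈ S, ℓ.Prime) {L : ℕ} (hL : L = M * ∏ ℓ ∈ S, ℓ ^ 2)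
    {p : ℕ} (hp : p.Prime) (hpS : p ∉ S) : p ∣ L ↔ p ∣ M := by
  rw [hL]
  refine ⟨fun h ↦ ?_, fun h ↦ h.mul_right _⟩
  rcases (Nat.Prime.dvd_mul hp).mp h with h | h
  · exact h
  · exfalso
    obtain ⟨ℓ, hℓ, hd⟩ := (Prime.dvd_finsetProd_iff hp.prime _).mp h
    have := (Nat.prime_dvd_prime_iff_eq hp (hS ℓ hℓ)).mp (hp.dvd_of_dvd_pow hd)
    exact hpS (this ▸ hℓ)

/-- Every `ℓ ∈ S` divides `L = M·∏_{ℓ∈S} ℓ²`. [folklore] -/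
private theorem dvd_level_of_mem {M : ℕ} {S : Finset ℕ} {L : ℕ} (hL : L = M * ∏ ℓ ∈ S, ℓ ^ 2) {ℓ : ℕ} (hℓ : ℓ ∈ S) :
    ℓ ∣ L := by
  rw [hL]
  exact ((dvd_pow_self ℓ two_ne_zero).trans (Finset.dvd_prod_of_mem (fun ℓ' ↦ ℓ' ^ 2) hℓ)).mul_left M

/-- **The depleted eigenform.** Let `f ∈ S₂(Γ₀(M))` be an eigenvector of every `T_p` with eigenvalue `a_p(f)`
(`p` prime; `U_p` for `p ∣ M`), with integer Fourier coefficients and `a₁(f) = 1` (e.g. the newform of an elliptic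
curve over `ℚ`), and let `S` be a finite set of primes. Then at level `L = M·∏_{ℓ∈S} ℓ²` there is a cusp form `g`
with: integer (hence real) coefficients, `a₁(g) = 1`, `a_n(g) = 𝟙_{(n,S)=1} a_n(f)`, `T_p g = a_p(f) g` for primes
`p ∉ S`, `U_ℓ g = 0` for `ℓ ∈ S`, and `T_p g = a_p(g) g` for every prime `p`. [cite: AtkinLehner1970, §3] -/
theorem exists_depleted_eigenform {M : ℕ} [NeZero M] (f : CuspForm (Gamma0 M) 2)
    (hint : ∀ n : ℕ, ∃ z : ℤ, cuspCoeff f n = z) (h1 : cuspCoeff f 1 = 1)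
    (hT : ∀ (p : ℕ) (hp : p.Prime), (haveI : NeZero p := ⟨hp.ne_zero⟩; heckeT (Gamma0 M) 2 p f) = cuspCoeff f p • f)
    (S : Finset ℕ) (hS : ∀ ℓ ∈ S, ℓ.Prime) (L : ℕ) [NeZero L] (hL : L = M * ∏ ℓ ∈ S, ℓ ^ 2) :
    ∃ g : CuspForm (Gamma0 L) 2,
      (∀ n : ℕ, cuspCoeff g n = if ∃ ℓ ∈ S, ℓ ∣ n then 0 else cuspCoeff f n) ∧
      (∀ n : ℕ, ∃ z : ℤ, cuspCoeff g n = z) ∧ (∀ n : ℕ, (cuspCoeff g n).im = 0) ∧ cuspCoeff g 1 = 1 ∧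
      (∀ (p : ℕ) (hp : p.Prime), p ∉ S → (haveI : NeZero p := ⟨hp.ne_zero⟩; heckeT (Gamma0 L) 2 p g) = cuspCoeff f p • g) ∧
      (∀ (ℓ : ℕ) (hℓ : ℓ.Prime), ℓ ∈ S → (haveI : NeZero ℓ := ⟨hℓ.ne_zero⟩; heckeT (Gamma0 L) 2 ℓ g) = 0) ∧
      (∀ (p : ℕ) (hp : p.Prime), (haveI : NeZero p := ⟨hp.ne_zero⟩; heckeT (Gamma0 L) 2 p g) = cuspCoeff g p • g) := by
  obtain ⟨g, hg⟩ := exists_cuspForm_coeff_eq_depleted f S hS L hL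
  have hreal : ∀ n : ℕ, (cuspCoeff f n).im = 0 := fun n ↦ by
    obtain ⟨z, hz⟩ := hint n
    rw [hz, Complex.intCast_im]
  refine ⟨g, hg, depleted_coeff_int hint hg, depleted_coeff_im hreal hg, (depleted_coeff_one hS hg).trans h1,
    fun p hp hpS ↦ depleted_heckeT_eq_smul hS hg hp hpS (dvd_level_iff hS hL hp hpS) (hT p hp),
    fun ℓ hℓ hℓS ↦ depleted_heckeT_eq_zero hg hℓ hℓS (dvd_level_of_mem hL hℓS),
    depleted_heckeT_eq_coeff_smul hS (fun ℓ h ↦ dvd_level_of_mem hL h) (fun p hp hpS ↦ dvd_level_iff hS hL hp hpS)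
      hg hT⟩

end Package

end DepletedFormCoefficients

section Periods

open _root_.Complex _root_.MeasureTheory _root_.Set

/-! ## §4. Periods of `ι_d h` and of level-raised forms -/

/-- An element of `Γ₀(N')` lies in `Γ₀(M)` when `M ∣ N'`. [folklore] -/
private theorem mem_gamma0_of_dvd {M N' : ℕ} (h : M ∣ N') (γ : Gamma0 N') : (γ : SL(2, ℤ)) ∈ Gamma0 M := by
  have hγ := γ.2
  rw [Gamma0_mem, ZMod.intCast_zmod_eq_zero_iff_dvd] at hγ ⊢
  exact (Int.natCast_dvd_natCast.mpr h).trans hγ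

/-- `{∞, γ∞}` of a level-raised form is the same period at the lower level. [folklore] -/
private theorem cuspSymbol_toLevel0 {M N' : ℕ} (h : M ∣ N') (g : CuspForm (Gamma0 M) 2) (γ : Gamma0 N') :
    cuspSymbol (toLevel0 h 2 g) γ = cuspSymbol g ⟨(γ : SL(2, ℤ)), mem_gamma0_of_dvd h γ⟩ := by
  rfl

/-- `{∞, r}_{ι_d h} = d⁻¹ · {∞, d r}_h`: the substitution `s = dt` in `(ι_d h)(z) = h(dz)`
(Cremona 1997, §2.4). [cite: CremonaAlgorithms1997, §2.4] -/
theorem modularSymbol_iota {M N' d : ℕ} [NeZero d] (h : M * d ∣ N') (g : CuspForm (Gamma0 M) 2) (r : ℚ) :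
    modularSymbol (iota M N' d 2 h g) r = (d : ℂ)⁻¹ * modularSymbol g (d * r) := by
  rw [modularSymbol, ← modularSymbol_slash_tpD d g r]
  have hcoe : ∀ t : ℝ, (iota M N' d 2 h g) (UpperHalfPlane.ofComplex ((r : ℂ) + t * I)) =
      (d : ℂ)⁻¹ * (⇑g ∣[(2 : ℤ)] tpD d) (UpperHalfPlane.ofComplex ((r : ℂ) + t * I)) := fun t ↦ by
    have := congrFun (coe_iota M N' d 2 h g) (UpperHalfPlane.ofComplex ((r : ℂ) + t * I))
    rw [this, Pi.smul_apply, smul_eq_mul]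
    norm_num
  simp_rw [hcoe]
  rw [integral_const_mul]
  ring

/-- **`{∞, γ∞}_{ι_d h} = d⁻¹ {∞, δ∞}_h` for some `δ ∈ Γ₀(M)`** (`γ ∈ Γ₀(N')`, `M d ∣ N'`): with
`γ∞ = a/c`, `c = d c'`, one has `d · (a/c) = a/c'` and `δ = (a *; c' *) ∈ Γ₀(M)`. [folklore] -/
private theorem exists_cuspSymbol_iota {M N' d : ℕ} [NeZero d] (h : M * d ∣ N') (g : CuspForm (Gamma0 M) 2)
    (γ : Gamma0 N') :
    ∃ δ : Gamma0 M, cuspSymbol (iota M N' d 2 h g) γ = (d : ℂ)⁻¹ * cuspSymbol g δ := by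
  by_cases hc : (γ : SL(2, ℤ)) 1 0 = 0
  · refine ⟨1, ?_⟩
    rw [cuspSymbol, if_pos hc, cuspSymbol_one, mul_zero]
  · set a : ℤ := (γ : SL(2, ℤ)) 0 0 with ha
    set c : ℤ := (γ : SL(2, ℤ)) 1 0 with hc'
    -- `N' ∣ c`, hence `d ∣ c` and `M ∣ c / d`
    have hN'c : (N' : ℤ) ∣ c := by
      have hγ := γ.2
      rw [Gamma0_mem, ZMod.intCast_zmod_eq_zero_iff_dvd] at hγ
      exact hγ
    have hdc : (d : ℤ) ∣ c :=
      ((Int.natCast_dvd_natCast.mpr (Dvd.intro_left _ rfl : d ∣ M * d)).trans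
        (Int.natCast_dvd_natCast.mpr h)).trans hN'c
    obtain ⟨c', hcc'⟩ := hdc
    have hd0 : (d : ℤ) ≠ 0 := by exact_mod_cast NeZero.ne d
    have hc'0 : c' ≠ 0 := by
      rintro rfl
      exact hc (by rw [hcc', mul_zero])
    have hMc' : (M : ℤ) ∣ c' := by
      have h1 : ((M * d : ℕ) : ℤ) ∣ c := (Int.natCast_dvd_natCast.mpr h).trans hN'c
      rw [hcc', Nat.cast_mul, mul_comm (M : ℤ)] at h1
      exact Int.dvd_of_mul_dvd_mul_left hd0 h1
    have hcop : IsCoprime a c' := by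
      have hdet := Matrix.SpecialLinearGroup.det_coe (γ : SL(2, ℤ))
      rw [Matrix.det_fin_two] at hdet
      have : IsCoprime a c := by
        refine ⟨(γ : SL(2, ℤ)) 1 1, -(γ : SL(2, ℤ)) 0 1, ?_⟩
        rw [ha, hc']
        linear_combination hdet
      rw [hcc'] at this
      exact this.of_mul_right_right
    refine ⟨Gamma0.mkOfCol a c' hcop hMc', ?_⟩
    rw [cuspSymbol, if_neg hc, modularSymbol_iota, cuspSymbol,
      if_neg (by rw [Gamma0.mkOfCol_apply_one_zero]; exact hc'0), Gamma0.mkOfCol_apply_zero_zero,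
      Gamma0.mkOfCol_apply_one_zero]
    congr 2
    rw [← ha, ← hc', hcc']
    push_cast
    have hc'Q : (c' : ℚ) ≠ 0 := by exact_mod_cast hc'0
    have hdQ : (d : ℚ) ≠ 0 := by exact_mod_cast NeZero.ne d
    field_simp


/-! ## §5. The periods of the `S`-depleted form lie in `(∏_{ℓ∈S} ℓ²)⁻¹ Λ_f` -/

/-- **`(∏_{ℓ∈S} ℓ²)·{∞, γ∞}_g ∈ Λ_f` at the depleted level `L = N·∏_{ℓ∈S} ℓ²`.** For `f ∈ S₂(Γ₀(N))` with integer
coefficients and `T_p f = a_p(f) f` for all primes `p`, a finite set `S` of primes, and `g ∈ S₂(Γ₀(L))` the `S`-depleted form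
(`a_n(g) = 𝟙_{(n,S)=1} a_n(f)`): every period `{∞, γ∞}_g`, `γ ∈ Γ₀(L)`, multiplied by `∏_{ℓ∈S} ℓ²`, is a period of `f`.
Induction over the sieve `g = K_ℓ g₀ = g₀ − a_ℓ ι_ℓ g₀ + 𝟙_{ℓ∤L₀} ℓ ι_ℓ ι_ℓ g₀` (Atkin–Lehner `f − f∣U_ℓ∣B_ℓ`) and
`{∞, γ∞}_{ι_ℓ h} = ℓ⁻¹ {∞, δ∞}_h` (`exists_cuspSymbol_iota`). [cite: AtkinLehner1970, §3] [cite: CremonaAlgorithms1997, §2.4] -/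
theorem mul_cuspSymbol_depleted_mem_of_eq {N : ℕ} [NeZero N] (f : CuspForm (Gamma0 N) 2)
    (hint : ∀ n : ℕ, ∃ z : ℤ, cuspCoeff f n = z)
    (hT : ∀ (p : ℕ) (hp : p.Prime), (haveI : NeZero p := ⟨hp.ne_zero⟩; heckeT (Gamma0 N) 2 p f) = cuspCoeff f p • f)
    (S : Finset ℕ) (hS : ∀ ℓ ∈ S, ℓ.Prime) (L : ℕ) [NeZero L] (hL : L = N * ∏ ℓ ∈ S, ℓ ^ 2)
    (g : CuspForm (Gamma0 L) 2) (hg : ∀ n : ℕ, cuspCoeff g n = if ∃ ℓ ∈ S, ℓ ∣ n then 0 else cuspCoeff f n)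
    (γ : Gamma0 L) : ((∏ ℓ ∈ S, ℓ ^ 2 : ℕ) : ℂ) * cuspSymbol g γ ∈ periodLattice f := by
  classical
  induction S using Finset.induction_on generalizing L g with
  | empty =>
    have hNL : N ∣ L := by rw [hL]; exact dvd_mul_right N _
    have hgf : g = toLevel0 hNL 2 f := by
      refine eq_of_forall_cuspCoeff_eq_gamma0 fun n ↦ ?_
      rw [hg n, if_neg (by simp)]
      rfl
    rw [Finset.prod_empty, Nat.cast_one, one_mul, hgf, cuspSymbol_toLevel0]
    exact cuspSymbol_mem_periodLattice f _
  | insert ℓ S hℓS ih =>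
    have hSp : ∀ ℓ' ∈ S, ℓ'.Prime := fun ℓ' h ↦ hS ℓ' (Finset.mem_insert_of_mem h)
    have hℓ : ℓ.Prime := hS ℓ (Finset.mem_insert_self ℓ S)
    set L₀ : ℕ := N * ∏ ℓ' ∈ S, ℓ' ^ 2 with hL₀
    haveI : NeZero L₀ := ⟨mul_ne_zero (NeZero.ne N) (prod_sq_ne_zero_of_prime S hSp)⟩
    haveI : NeZero ℓ := ⟨hℓ.ne_zero⟩
    obtain ⟨g₀, hg₀⟩ := exists_cuspForm_coeff_eq_depleted f S hSp L₀ rfl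
    have hL' : L = L₀ * ℓ * ℓ := by
      rw [hL, Finset.prod_insert hℓS, hL₀]; ring
    subst hL'
    -- `g` is the sieve of `g₀`
    have hgs : g = sieveOp L₀ 2 ℓ g₀ := by
      refine eq_of_forall_cuspCoeff_eq_gamma0 fun n ↦ ?_
      rw [hg n]
      change _ = (UpperHalfPlane.qExpansion 1 ⇑(sieveOp L₀ 2 ℓ g₀)).coeff n
      rw [qExpansion_coeff_sieveOp hℓ g₀ n]
      change _ = (if ℓ ∣ n then 0 else cuspCoeff g₀ n)
      rw [hg₀ n]
      by_cases hℓn : ℓ ∣ n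
      · rw [if_pos hℓn, if_pos ⟨ℓ, Finset.mem_insert_self ℓ S, hℓn⟩]
      · rw [if_neg hℓn]
        by_cases hex : ∃ ℓ' ∈ S, ℓ' ∣ n
        · obtain ⟨ℓ', hℓ', hd⟩ := hex
          rw [if_pos ⟨ℓ', Finset.mem_insert_of_mem hℓ', hd⟩, if_pos ⟨ℓ', hℓ', hd⟩]
        · rw [if_neg hex, if_neg]
          rintro ⟨ℓ', hℓ', hd⟩
          rcases Finset.mem_insert.mp hℓ' with rfl | h
          · exact hℓn hd
          · exact hex ⟨ℓ', h, hd⟩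
    -- the eigenvalue `a_ℓ ∈ ℤ` of `g₀`
    obtain ⟨a, ha⟩ := hint ℓ
    have hTg₀ : heckeT (Gamma0 L₀) 2 ℓ g₀ = (a : ℂ) • g₀ := by
      rw [← ha]
      exact depleted_heckeT_eq_smul hSp hg₀ hℓ hℓS (dvd_level_iff hSp rfl hℓ hℓS) (hT ℓ hℓ)
    -- the three periods of `g₀` entering `{∞, γ∞}_g`
    obtain ⟨δ, hδ⟩ := exists_cuspSymbol_iota (dvd_rfl : L₀ * ℓ * ℓ ∣ L₀ * ℓ * ℓ) (uOp L₀ 2 ℓ g₀) γ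
    obtain ⟨δ', hδ'⟩ := exists_cuspSymbol_iota (dvd_rfl : L₀ * ℓ ∣ L₀ * ℓ) g₀ δ
    set γ₀ : Gamma0 L₀ := ⟨(γ : SL(2, ℤ)), mem_gamma0_of_dvd (⟨ℓ * ℓ, by ring⟩ : L₀ ∣ L₀ * ℓ * ℓ) γ⟩ with hγ₀
    set δ₀ : Gamma0 L₀ := ⟨(δ : SL(2, ℤ)), mem_gamma0_of_dvd (dvd_mul_right L₀ ℓ) δ⟩ with hδ₀
    have hx₀ := ih hSp L₀ rfl g₀ hg₀ γ₀
    have hx₁ := ih hSp L₀ rfl g₀ hg₀ δ₀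
    have hx₂ := ih hSp L₀ rfl g₀ hg₀ δ'
    set D : ℕ := ∏ ℓ' ∈ S, ℓ' ^ 2 with hD
    -- `{∞, γ∞}_g` in terms of the periods of `g₀`
    have huOp : cuspSymbol (uOp L₀ 2 ℓ g₀) δ =
        (a : ℂ) * cuspSymbol g₀ δ₀ - (if ℓ ∣ L₀ then (0 : ℂ) else (ℓ : ℂ)) * ((ℓ : ℂ)⁻¹ * cuspSymbol g₀ δ') := by
      rw [← periodFunctional_apply, uOp, LinearMap.sub_apply, LinearMap.comp_apply, LinearMap.smul_apply, map_sub,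
        map_smul, periodFunctional_apply, periodFunctional_apply, cuspSymbol_toLevel0, hTg₀, cuspSymbol_smul, hδ',
        smul_eq_mul]
      congr 2
      split_ifs <;> simp
    have hper : cuspSymbol g γ = cuspSymbol g₀ γ₀ - (ℓ : ℂ)⁻¹ * cuspSymbol (uOp L₀ 2 ℓ g₀) δ := by
      rw [hgs, ← periodFunctional_apply, sieveOp, LinearMap.sub_apply, LinearMap.comp_apply, map_sub,
        periodFunctional_apply, periodFunctional_apply, cuspSymbol_toLevel0, hδ]
    have hℓ0 : (ℓ : ℂ) ≠ 0 := by exact_mod_cast hℓ.ne_zero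
    rw [Finset.prod_insert hℓS, hper, huOp]
    by_cases hℓL₀ : ℓ ∣ L₀
    · rw [if_pos hℓL₀]
      have key : ((ℓ ^ 2 * D : ℕ) : ℂ) * (cuspSymbol g₀ γ₀ - (ℓ : ℂ)⁻¹ * ((a : ℂ) * cuspSymbol g₀ δ₀ -
          0 * ((ℓ : ℂ)⁻¹ * cuspSymbol g₀ δ'))) =
          ((ℓ : ℤ) ^ 2) • ((D : ℂ) * cuspSymbol g₀ γ₀) - ((ℓ : ℤ) * a) • ((D : ℂ) * cuspSymbol g₀ δ₀) := by
        simp only [zsmul_eq_mul]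
        push_cast
        field_simp
        ring
      rw [key]
      exact sub_mem (AddSubgroup.zsmul_mem _ hx₀ _) (AddSubgroup.zsmul_mem _ hx₁ _)
    · rw [if_neg hℓL₀]
      have key : ((ℓ ^ 2 * D : ℕ) : ℂ) * (cuspSymbol g₀ γ₀ - (ℓ : ℂ)⁻¹ * ((a : ℂ) * cuspSymbol g₀ δ₀ -
          (ℓ : ℂ) * ((ℓ : ℂ)⁻¹ * cuspSymbol g₀ δ'))) =
          ((ℓ : ℤ) ^ 2) • ((D : ℂ) * cuspSymbol g₀ γ₀) - ((ℓ : ℤ) * a) • ((D : ℂ) * cuspSymbol g₀ δ₀) +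
            (ℓ : ℤ) • ((D : ℂ) * cuspSymbol g₀ δ') := by
        simp only [zsmul_eq_mul]
        push_cast
        field_simp
        ring
      rw [key]
      exact add_mem (sub_mem (AddSubgroup.zsmul_mem _ hx₀ _) (AddSubgroup.zsmul_mem _ hx₁ _))
        (AddSubgroup.zsmul_mem _ hx₂ _)

/-! ## §6. Flexible level: the lattice `Λ_g` lies in `(∏ℓ²)⁻¹Λ_f` -/

/-- **`(∏_{ℓ∈S} ℓ²)·{∞, γ∞}_g ∈ Λ_f` at ANY level `L` with `N·∏_{ℓ∈S} ℓ² ∣ L`** (the `S`-depleted form at level `L` is the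
level-raised depleted form of level `N·∏ℓ²`, same function on `ℍ`). [cite: AtkinLehner1970, §3] -/
theorem mul_cuspSymbol_depleted_mem {N : ℕ} [NeZero N] (f : CuspForm (Gamma0 N) 2)
    (hint : ∀ n : ℕ, ∃ z : ℤ, cuspCoeff f n = z)
    (hT : ∀ (p : ℕ) (hp : p.Prime), (haveI : NeZero p := ⟨hp.ne_zero⟩; heckeT (Gamma0 N) 2 p f) = cuspCoeff f p • f)
    (S : Finset ℕ) (hS : ∀ ℓ ∈ S, ℓ.Prime) (L : ℕ) [NeZero L] (hNL : N * ∏ ℓ ∈ S, ℓ ^ 2 ∣ L)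
    (g : CuspForm (Gamma0 L) 2) (hg : ∀ n : ℕ, cuspCoeff g n = if ∃ ℓ ∈ S, ℓ ∣ n then 0 else cuspCoeff f n)
    (γ : Gamma0 L) : ((∏ ℓ ∈ S, ℓ ^ 2 : ℕ) : ℂ) * cuspSymbol g γ ∈ periodLattice f := by
  classical
  set L₀ : ℕ := N * ∏ ℓ ∈ S, ℓ ^ 2 with hL₀
  haveI : NeZero L₀ := ⟨mul_ne_zero (NeZero.ne N) (prod_sq_ne_zero_of_prime S hS)⟩
  obtain ⟨g₀, hg₀⟩ := exists_cuspForm_coeff_eq_depleted f S hS L₀ rfl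
  have hgs : g = toLevel0 hNL 2 g₀ := by
    refine eq_of_forall_cuspCoeff_eq_gamma0 fun n ↦ ?_
    rw [hg n]
    exact (hg₀ n).symm
  rw [hgs, cuspSymbol_toLevel0]
  exact mul_cuspSymbol_depleted_mem_of_eq f hint hT S hS L₀ rfl g₀ hg₀ _

/-- **`(∏_{ℓ∈S} ℓ²) · Λ_g ⊆ Λ_f`**: the period group of the `S`-depleted form `g` (level `L`, `N·∏_{ℓ∈S} ℓ² ∣ L`) of a Hecke
eigenform `f ∈ S₂(Γ₀(N))` with integer coefficients lies in `(∏ ℓ²)⁻¹ Λ_f`. [cite: AtkinLehner1970, §3]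
[cite: CremonaAlgorithms1997, §2.4] -/
theorem mul_mem_periodLattice_of_mem_periodLattice_depleted {N : ℕ} [NeZero N] (f : CuspForm (Gamma0 N) 2)
    (hint : ∀ n : ℕ, ∃ z : ℤ, cuspCoeff f n = z)
    (hT : ∀ (p : ℕ) (hp : p.Prime), (haveI : NeZero p := ⟨hp.ne_zero⟩; heckeT (Gamma0 N) 2 p f) = cuspCoeff f p • f)
    (S : Finset ℕ) (hS : ∀ ℓ ∈ S, ℓ.Prime) (L : ℕ) [NeZero L] (hNL : N * ∏ ℓ ∈ S, ℓ ^ 2 ∣ L)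
    (g : CuspForm (Gamma0 L) 2) (hg : ∀ n : ℕ, cuspCoeff g n = if ∃ ℓ ∈ S, ℓ ∣ n then 0 else cuspCoeff f n) :
    ∀ z ∈ periodLattice g, ((∏ ℓ ∈ S, ℓ ^ 2 : ℕ) : ℂ) * z ∈ periodLattice f := by
  have hle : periodLattice g ≤ (periodLattice f).comap (AddMonoidHom.mulLeft ((∏ ℓ ∈ S, ℓ ^ 2 : ℕ) : ℂ)) := by
    rw [periodLattice, AddSubgroup.closure_le]
    rintro _ ⟨γ, rfl⟩
    exact mul_cuspSymbol_depleted_mem f hint hT S hS L hNL g hg γ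
  exact fun z hz ↦ hle hz

end Periods

end Literature.NumberTheory.EllipticCurves.ModularForms.DepletedForm

end
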